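import Summits.ABC.IUTFork.Cor312EdgeYamashita
import Summits.ABC.IUTFork.Cor312EdgeIsoCopy
import HarnessLib

/-!
# [IUTchIII] Corollary 3.12 — readings of the edge, IV bis: Reading 4 versus the inequality itself under an
# intermediate-value property (proof-only companion of `Cor312EdgeYamashita.lean`)

Record-only file (D-0012) of the abc-iut cell; TAKES NO SIDE. Three seats typed Yamashita's rendering of
[IUTchIII] Cor. 3.12 Step (xi) (Yamashita2024IUTSurvey Cor. 13.13, proof p. 360 ll. 30–40: the hull "contains a
region which is isomorphic (not equal) to the region determined by the q-pilot objects") at VOLUME level as the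
SAME `Prop` over skel XVII's `Cor312Setting` — `QIsoInHull` (skel, `ForkRegions` §7), `QCongruentSubHull`
(c312-2, V-d `Cor312EdgeYamashita`), `QCopyInHull` (c312-10, `Cor312EdgeIsoCopy`): "`U^{hol}` contains an
admissible region of log-volume `−|log(q)|`" (`readings4_coincide`, three `Iff.rfl`). Each file shows that this
Reading 4 suffices for Cor. 3.12 and separates it from the bare inequality by a finite witness with INTEGER-valued
log-volume (`edge_not_imp_yamashita`, `cor312_not_imp_qCopyInHull`); V-e `Cor312EdgeAggregate` says in prose
("HOW LITTLE IS LEFT") that the separation disappears under an intermediate-value property.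

This companion is the KERNEL form of that prose remark (RQ7 second pass of p411306 by abc-iut-w5-d018), over the
same abstract settings, nothing asserted about any model:

* single container: `qCongruentSubHull_of_eq` (equality case free, `R := U^{hol}`);
  `qCongruentSubHull_iff_cor312_of_ivt` — if admissible sub-regions of `U^{hol}` realise every admissible
  log-volume value `≤ ln ν̄(U^{hol})`, then Reading 4 (volume level) ⟺ Cor. 3.12; likewise for c312-10's
  approximate form (`qCopyInHullApprox_iff_cor312_of_ivt`);
* transport level: `qIsoSubHull_of_qCongruentSubHull_of_homogeneous` — for a family `Φ` HOMOGENEOUS on admissible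
  regions of equal log-volume, V-d's transport form `QIsoSubHull Φ` follows from the volume form, i.e. it constrains
  exactly as much as `Φ` is pinned to the maps (Indet ↷), (Indet →) induce (not modelled in V-d, as said there);
* aggregate level (V-e's abstract finite family `C : ι → Cor312Setting`, `AggCor312`/`AggCongruent`): the twin statement
  `aggCongruent_of_aggCor312_of_ivt_at` (intermediate values at ONE component suffice) is the sibling file
  `Cor312EdgeAggregateIVT.lean`, filed once V-e `Cor312EdgeAggregate.lean` (p413228) has an olean.

So, with the print's global quantifier and honest (non-atomic) containers, Reading 4 carries no content beyond
the inequality; the content of Yamashita's sentence is WHICH isomorphism carries the `q`-pilot region into the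
hull. Bookkeeping only: nothing here asserts that any reading is supplied or excluded by [IUTchIII]; typed ≠ proved;
no side is taken on Cor. 3.12. [cite: Yamashita2024IUTSurvey, Cor. 13.13 proof p. 360 ll. 30–40]
-/

noncomputable section

namespace Summit.ABC.IUTFork

open Set

namespace Cor312Setting

variable (C : Cor312Setting)

/-- The three volume-level typings of Reading 4 in the tree are ONE `Prop` (identical bodies): skel XVII
`QIsoInHull`, c312-2 `QCongruentSubHull`, c312-10 `QCopyInHull`. [folklore] -/
theorem readings4_coincide :
    (C.QIsoInHull ↔ C.QCongruentSubHull) ∧ (C.QCongruentSubHull ↔ C.QCopyInHull) ∧ (C.QCopyInHull ↔ C.QIsoInHull) :=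
  ⟨Iff.rfl, Iff.rfl, Iff.rfl⟩

/-- The equality case of Cor. 3.12 (`−|log(q)| = −|log(Θ)|`) yields Reading 4 at volume level with
`R := U^{hol}` — no isomorphism needed. [folklore] -/
theorem qCongruentSubHull_of_eq (h : C.negAbsLogq = C.negLogTheta) : C.QCongruentSubHull :=
  ⟨C.Uhol, C.adm_Uhol, subset_rfl, h.symm⟩

/-- **Reading 4 (volume level) ⟺ Cor. 3.12 under an intermediate-value property.** If every admissible
log-volume value `y ≤ ln ν̄(U^{hol})` is realised by an admissible sub-region of `U^{hol}` (hypothesis `ivt` —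
intermediate values / homogeneity of the container, e.g. any honest Haar container with a non-atomic, say
archimedean, factor), then `QCongruentSubHull ↔ Cor312`. Hence V-d's separation
`Cor312Proof.edge_not_imp_yamashita` (integer-valued `ln ν̄`) is an atomic-volume phenomenon. [folklore] -/
theorem qCongruentSubHull_iff_cor312_of_ivt
    (ivt : ∀ y : ℝ, (∃ A, C.Adm A ∧ C.logvol A = y) → y ≤ C.logvol C.Uhol →
      ∃ R, C.Adm R ∧ R ⊆ C.Uhol ∧ C.logvol R = y) :
    C.QCongruentSubHull ↔ C.Cor312 := by
  refine ⟨C.cor312_of_qCongruentSubHull, fun h => ?_⟩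
  obtain ⟨R, hR, hsub, hvol⟩ := ivt C.negAbsLogq ⟨C.Q, C.Q_adm, rfl⟩ h
  exact ⟨R, hR, hsub, hvol⟩

/-- The same for c312-10's APPROXIMATE form of Reading 4 (the (xi-f) hedge "perhaps only up to some sort of
approximation"): under `ivt`, `QCopyInHullApprox ↔ Cor312`. [folklore] -/
theorem qCopyInHullApprox_iff_cor312_of_ivt
    (ivt : ∀ y : ℝ, (∃ A, C.Adm A ∧ C.logvol A = y) → y ≤ C.logvol C.Uhol →
      ∃ R, C.Adm R ∧ R ⊆ C.Uhol ∧ C.logvol R = y) :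
    C.QCopyInHullApprox ↔ C.Cor312 :=
  ⟨C.cor312_of_qCopyInHullApprox, fun h =>
    C.qCopyInHullApprox_of_qCopyInHull ((C.qCongruentSubHull_iff_cor312_of_ivt ivt).2 h)⟩

/-- **Transport level from volume level, for a homogeneous family.** If the family `Φ` matches any two
admissible regions of equal log-volume (hypothesis `hom`), then Reading 4 at volume level already gives V-d's
Reading 4 at transport level for `Φ`: the transport form adds content only in so far as `Φ` is pinned to the
isomorphisms the indeterminacies induce. [folklore] -/
theorem qIsoSubHull_of_qCongruentSubHull_of_homogeneous (Φ : IsoFamily C)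
    (hom : ∀ A B : Set C.L, C.Adm A → C.Adm B → C.logvol A = C.logvol B → ∃ i, Φ.map i '' A = B)
    (h : C.QCongruentSubHull) : C.QIsoSubHull Φ := by
  obtain ⟨R, hR, hsub, hvol⟩ := h
  obtain ⟨i, hi⟩ := hom C.Q R C.Q_adm hR hvol.symm
  exact ⟨i, by rw [hi]; exact hsub⟩

/-- Under both hypotheses the three statements `Cor312`, `QCongruentSubHull`, `QIsoSubHull Φ` coincide.
[folklore] -/
theorem qIsoSubHull_iff_cor312_of_ivt_of_homogeneous (Φ : IsoFamily C)
    (ivt : ∀ y : ℝ, (∃ A, C.Adm A ∧ C.logvol A = y) → y ≤ C.logvol C.Uhol →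
      ∃ R, C.Adm R ∧ R ⊆ C.Uhol ∧ C.logvol R = y)
    (hom : ∀ A B : Set C.L, C.Adm A → C.Adm B → C.logvol A = C.logvol B → ∃ i, Φ.map i '' A = B) :
    C.QIsoSubHull Φ ↔ C.Cor312 :=
  ⟨C.cor312_of_qIsoSubHull Φ, fun h => C.qIsoSubHull_of_qCongruentSubHull_of_homogeneous Φ hom
    ((C.qCongruentSubHull_iff_cor312_of_ivt ivt).2 h)⟩

end Cor312Setting


end Summit.ABC.IUTFork

end
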